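import Mathlib
import Literature.Analysis.FluidPDE.TypeIICoreWitness
import Literature.Analysis.FluidPDE.VectorCalculus
import Literature.Analysis.FluidPDE.IsometryInvariance
import Summits.NavierStokesRegularity.NavierStokesRegularity.Theorems.TypeIIInviscidRelaxationColumnarCoreExclusionDivFreeDatum
import Summits.NavierStokesRegularity.NavierStokesRegularity.Theorems.TypeIIInviscidRelaxationColumnarCoreExclusionStreamCutoff
import HarnessLib

/-!
# Crux `ColumnarCoreExclusion` (stmt-NavierStokesRegularity-1966), line `columnar_comparison_flow`:
# the complete comparison DATUM — smooth, exactly divergence-free, exactly columnar along the witness axis,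
# supported in the solid cylinder of radius `KL` about the axis, bounded, and `3V/K`-close to the core
# slice on the half core ball (steps R3a–R3c of `stub_columnarComparisonFlow`, glued)

`--supports stmt-NavierStokesRegularity-1966` (helper file; theorems only, no definitions, no `sorry`).

Glue of `exists_corrected_divFree_columnar_close` (`…DivFreeDatum`: corrected axial window average `w`,
`3V/K`-close on `‖Y‖ ≤ KL/2`) with `exists_divFree_columnar_cutoff` (`…StreamCutoff`: stream-function cut-off
between the radii `R = KL/2` and `R' = KL`; the stub needs closeness only on the OPEN half ball, where the
cut-off field equals `w`), conjugated back by the witness frame `(x₀, Q)`.  What remains for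
`stub_columnarComparisonFlow` after this file is only the 2½-dimensional LAUNCH of this datum (2D
Navier–Stokes on `𝕋²` is in the tree, `Torus.exists_classicalNS_forced_fin_two`; the classical passive-scalar
vertical component and the columnar lift are not).  Nothing here closes a stub, the crux, or says anything
about Navier–Stokes regularity.
-/

noncomputable section

open Literature.Analysis.FluidPDE Set Metric MeasureTheory Real Function
open scoped RealInnerProductSpace ContDiff

namespace Summit.NavierStokesRegularity.NavierStokesRegularity.Theorems

-- the problem directory repeats the summit name (`NavierStokesRegularity/NavierStokesRegularity`)
set_option linter.dupNamespace false

namespace ColumnarComparisonDatum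

/-- **The comparison datum of `stub_columnarComparisonFlow` (steps R3a–R3c).**  Let `u t` be a smooth
divergence-free slice bounded by `V` whose recentred, rotated, rescaled copy `y ↦ V⁻¹ Q⁻¹ u(t)(x₀ + L Q y)` is
`K⁻¹`-close on `‖y‖ ≤ K` to a columnar profile `W` (`K, L, V > 0`).  Then there is a smooth `v₀ : ℝ³ → ℝ³`,
EXACTLY divergence free, EXACTLY columnar along the witness axis (`v₀ (x + τ • Q e_z) = v₀ x`), vanishing
outside the solid cylinder of radius `KL` about the axis (in witness coordinates `Y = Q⁻¹(x − x₀)`: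
`(KL)² < Y₀² + Y₁² ⇒ v₀ x = 0`), bounded, with `‖u t x − v₀ x‖ ≤ 3V/K` on `ball x₀ (K * L / 2)`. [folklore] -/
theorem exists_compact_divFree_columnar_datum
    (u : ℝ → EuclideanSpace ℝ (Fin 3) → EuclideanSpace ℝ (Fin 3)) (t : ℝ) (hu : ContDiff ℝ ∞ (u t))
    (hdivu : VectorCalculus.IsDivFree (u t))
    (x₀ : EuclideanSpace ℝ (Fin 3)) (L V K : ℝ)
    (Q : EuclideanSpace ℝ (Fin 3) ≃ₗᵢ[ℝ] EuclideanSpace ℝ (Fin 3))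
    (W : EuclideanSpace ℝ (Fin 3) → EuclideanSpace ℝ (Fin 3))
    (hL : 0 < L) (hV : 0 < V) (hK : 0 < K) (hW : IsColumnar W)
    (hbd : ∀ x, ‖u t x‖ ≤ V)
    (hclose : ∀ y : EuclideanSpace ℝ (Fin 3), ‖y‖ ≤ K →
      ‖V⁻¹ • Q.symm (u t (x₀ + L • Q y)) - W y‖ ≤ K⁻¹) :
    ∃ v₀ : EuclideanSpace ℝ (Fin 3) → EuclideanSpace ℝ (Fin 3),
      ContDiff ℝ ∞ v₀ ∧ VectorCalculus.IsDivFree v₀ ∧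
      (∀ (x : EuclideanSpace ℝ (Fin 3)) (τ : ℝ), v₀ (x + τ • Q eZ) = v₀ x) ∧
      (∀ x, (K * L) ^ 2 < (Q.symm (x - x₀)) 0 ^ 2 + (Q.symm (x - x₀)) 1 ^ 2 → v₀ x = 0) ∧
      (∃ M, ∀ x, ‖v₀ x‖ ≤ M) ∧
      (∀ x ∈ ball x₀ (K * L / 2), ‖u t x - v₀ x‖ ≤ 3 * V / K) := by
  have hKL : 0 < K * L := mul_pos hK hL
  -- the slice in witness coordinates
  set g : EuclideanSpace ℝ (Fin 3) → EuclideanSpace ℝ (Fin 3) := fun y => Q.symm (u t (x₀ + Q y))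
    with hg_def
  have hg : ContDiff ℝ ∞ g :=
    Q.symm.contDiff.comp (hu.comp (contDiff_const.add Q.contDiff))
  have hdivg : VectorCalculus.IsDivFree g := by
    have h1 : VectorCalculus.IsDivFree fun y => u t (y + x₀) := isDivFree_comp_add hdivu x₀
    have h2 := h1.conj_linearIsometryEquiv (R := Q.symm)
    refine fun y => ?_
    have := h2 y
    simpa [hg_def, add_comm] using this
  have hbdg : ∀ y, ‖g y‖ ≤ V := fun y => by
    rw [hg_def]; simp only [LinearIsometryEquiv.norm_map]; exact hbd _
  have hclose_g : ∀ y : EuclideanSpace ℝ (Fin 3), ‖y‖ ≤ K → ‖V⁻¹ • g (L • y) - W y‖ ≤ K⁻¹ := by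
    intro y hy
    have e : x₀ + L • Q y = x₀ + Q (L • y) := by rw [map_smul]
    have := hclose y hy
    rw [e] at this
    exact this
  obtain ⟨w, hws, hwdiv, hwcol, hwclose, -⟩ :=
    exists_corrected_divFree_columnar_close g hg hdivg L V K W hL hV hK hW hbdg hclose_g
  -- stream function and cut-off between the radii `KL/2` and `KL`
  obtain ⟨ψ, hψ⟩ : ∃ ψ : EuclideanSpace ℝ (Fin 3) → ℝ,
      ψ = fun Y => (∫ s in (0 : ℝ)..(Y 1), w (Y + (s - Y 1) • EuclideanSpace.single 1 1) 0) -
        ∫ s in (0 : ℝ)..(Y 0), w (s • EuclideanSpace.single 0 1) 1 := ⟨_, rfl⟩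
  obtain ⟨v, hvs, hvdiv, hvcol, hvin, hvout, M, hM⟩ :=
    exists_divFree_columnar_cutoff hws hwdiv hwcol hψ (R := K * L / 2) (R' := K * L) (by positivity)
      (by linarith)
  refine ⟨fun x => Q (v (Q.symm (x - x₀))), ?_, ?_, ?_, ?_, ⟨M, fun x => ?_⟩, ?_⟩
  · exact Q.contDiff.comp (hvs.comp (Q.symm.contDiff.comp (contDiff_id.sub contDiff_const)))
  · have h1 := hvdiv.conj_linearIsometryEquiv (R := Q)
    have h2 := isDivFree_comp_add h1 (-x₀)
    simpa [sub_eq_add_neg] using h2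
  · intro x τ
    show Q (v (Q.symm (x + τ • Q eZ - x₀))) = Q (v (Q.symm (x - x₀)))
    rw [show x + τ • Q eZ - x₀ = (x - x₀) + τ • Q eZ by abel, map_add,
      LinearIsometryEquiv.map_smul, LinearIsometryEquiv.symm_apply_apply, hvcol]
  · intro x hx
    show Q (v (Q.symm (x - x₀))) = 0
    rw [hvout _ (by simpa [mul_pow] using hx), map_zero]
  · rw [LinearIsometryEquiv.norm_map]; exact hM _
  · intro x hx
    set Y : EuclideanSpace ℝ (Fin 3) := Q.symm (x - x₀) with hY_def
    have hYlt : ‖Y‖ < K * L / 2 := by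
      rw [hY_def, LinearIsometryEquiv.norm_map, ← dist_eq_norm]; exact mem_ball.1 hx
    have hY : ‖Y‖ ≤ K * L / 2 := hYlt.le
    have hin : Y 0 ^ 2 + Y 1 ^ 2 < (K * L / 2) ^ 2 := by
      have hsq : ‖Y‖ ^ 2 = Y 0 ^ 2 + Y 1 ^ 2 + Y 2 ^ 2 := by
        rw [EuclideanSpace.real_norm_sq_eq, Fin.sum_univ_three]
      have h2 : ‖Y‖ ^ 2 < (K * L / 2) ^ 2 := pow_lt_pow_left₀ hYlt (norm_nonneg _) two_ne_zero
      nlinarith [sq_nonneg (Y 2)]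
    have hfx : u t x = Q (g Y) := by
      rw [hg_def, hY_def]
      simp
    rw [hfx]
    show ‖Q (g Y) - Q (v Y)‖ ≤ 3 * V / K
    rw [hvin Y hin, ← map_sub, LinearIsometryEquiv.norm_map]
    exact hwclose Y hY

end ColumnarComparisonDatum

end Summit.NavierStokesRegularity.NavierStokesRegularity.Theorems

end
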